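import Summits.QuantumFields.YangMills.Theorems.FlatTubeReductionOffTubeSuppression
import Summits.QuantumFields.YangMills.Theorems.FemtoCutoffLadderFixedLatticeLawOfTube
import Summits.QuantumFields.YangMills.Theses.FlatTubeReduction
import HarnessLib

/-!
# Route `FlatTubeReduction` — the `Assembly` item (stmt-QuantumFields-24722) PROVED, and the route after K2:
# `NearFlatRatioLaw` ALONE gives the fixed-lattice Lüscher law (FemtoCutoffLadder's node `FixedLatticeLaw`, stmt-QuantumFields-23943)

Seat `ym-line-sfw-p1` g9 (prover; planner-of-record ym-idea-1).  Rung R2b1 = the RECORD-label femto transfer gap `FemtoGapOfRecord` — NOT infinite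
volume, NOT the Clay mass gap, no summit.

* ★ `assembly_proof : Assembly` (`NearFlatRatioLaw → OffTubeSuppression → OctaveStepDecay → SubOctaveBounded → FemtoGapOfRecord`): the planner's
  composition — K1 ∧ K2 ⟹ `FemtoGapFixedLattice` (seat fcl-p3's `FemtoCutoffLadder.femtoGapFixedLattice_of_nearFlat_offTube`: min–max from the exact
  positive ground state, K2 then K1 on the tube state, collar absorbed by the proved one-site lower law), then FemtoCutoffLadder's proved tower
  assembly (`femtoGapOfRecord_of_steps_of_fixedLattice'`: coarse pairs from the leaf, closed anchor / matching, the route-independent tower ladder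
  `CutoffLadder.femtoGapOfRecord_of_towerLadder`), the two ladder legs being shared verbatim with that route.
* Since K2 `OffTubeSuppression` is now a THEOREM (`FlatTubeReduction.offTubeSuppression_proof`, file `FlatTubeReductionOffTubeSuppression.lean`):
  ★★ `femtoGapFixedLattice_of_nearFlatRatioLaw : NearFlatRatioLaw → FemtoGapFixedLattice`,
  ★★ `fixedLatticeLaw_of_nearFlatRatioLaw : NearFlatRatioLaw → Theses.FemtoCutoffLadder.FixedLatticeLaw` (FCL's node 23943 ⇐ K1 alone), and
  ★★ `femtoGapOfRecord_of_nearFlatRatioLaw_steps : NearFlatRatioLaw → OctaveStepDecay → SubOctaveBounded → FemtoGapOfRecord`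
  — route FlatTubeReduction now stands on exactly {K1 `NearFlatRatioLaw`, `OctaveStepDecay`, `SubOctaveBounded`}.

HONEST FRAMING: bookkeeping; K1 (XL: the degenerate toron-valley Born–Oppenheimer comparison at precision `λ_b²/L`) and the two ladder legs (behind
`UVStabilityNonUniqueness`) are OPEN and untouched.  No definitions, no named facts, no `sorry`.
-/

set_option autoImplicit false

namespace Summit.QuantumFields.YangMills.Theorems.FlatTubeReduction

open Summit.QuantumFields.YangMills.Theses.FlatTubeReduction

/-- FemtoCutoffLadder's tower assembly read with this route's (verbatim shared) ladder legs:
`OctaveStepDecay → SubOctaveBounded → FemtoGapFixedLattice → FemtoGapOfRecord` — coarse pairs from the leaf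
(`FemtoCutoffLadder.coarsePairScaling_of_fixedLattice`, read at exponent 1), the closed anchor / matching items, and the route-independent
tower ladder `FemtoTransferGap.CutoffLadder.femtoGapOfRecord_of_towerLadder` (= FCL's `femtoGapOfRecord_of_steps_of_fixedLattice`, inlined).
[cite: LuscherWeiszWolff1991] [cite: Luscher1983, §3] -/
theorem femtoGapOfRecord_of_steps_of_fixedLattice' (h₃ : OctaveStepDecay) (h₄ : SubOctaveBounded)
    (hFL : Summit.QuantumFields.YangMills.Theorems.FemtoTransferGap.FemtoGapFixedLattice) :
    Summit.QuantumFields.YangMills.Theorems.FemtoTransferGap.FemtoGapOfRecord := by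
  have h₅ := Summit.QuantumFields.YangMills.Theorems.FemtoCutoffLadder.coarsePairScaling_of_fixedLattice hFL
  refine Summit.QuantumFields.YangMills.Theorems.FemtoTransferGap.CutoffLadder.femtoGapOfRecord_of_towerLadder h₃ h₄ ?_
    Summit.QuantumFields.YangMills.Theorems.FemtoCutoffLadder.oneSiteWindowAnchor_proof
    Summit.QuantumFields.YangMills.Theorems.FemtoCutoffLadder.matchedCouplingExists_proof
  intro L _
  obtain ⟨C, lam0, hlam0, H⟩ := h₅ L
  refine ⟨C, lam0, hlam0, fun lam hlam hle β β' hW hW' hm => ?_⟩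
  simpa only [pow_one] using H lam hlam hle β β' hW hW' hm

/-- ★★ **K1 alone gives the fixed-lattice leaf** (K2 discharged by `offTubeSuppression_proof`):
`NearFlatRatioLaw → FemtoGapFixedLattice`. [cite: Luscher1983, §3] -/
theorem femtoGapFixedLattice_of_nearFlatRatioLaw (h₁ : NearFlatRatioLaw) :
    Summit.QuantumFields.YangMills.Theorems.FemtoTransferGap.FemtoGapFixedLattice :=
  Summit.QuantumFields.YangMills.Theorems.FemtoCutoffLadder.femtoGapFixedLattice_of_nearFlat_offTube h₁ offTubeSuppression_proof

/-- ★★ **FemtoCutoffLadder's node `FixedLatticeLaw` (stmt-QuantumFields-23943) ⇐ K1 alone**, by name. [cite: Luscher1983, §3] -/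
theorem fixedLatticeLaw_of_nearFlatRatioLaw (h₁ : NearFlatRatioLaw) :
    Summit.QuantumFields.YangMills.Theses.FemtoCutoffLadder.FixedLatticeLaw :=
  Summit.QuantumFields.YangMills.Theorems.FemtoCutoffLadder.fixedLatticeLaw_of_nearFlat_offTube h₁ offTubeSuppression_proof

/-- ★★ **The route after K2**: `NearFlatRatioLaw → OctaveStepDecay → SubOctaveBounded → FemtoGapOfRecord` (the two ladder legs are the
FemtoCutoffLadder items stmt-QuantumFields-24153 / 24085, verbatim). [cite: LuscherWeiszWolff1991] [cite: Luscher1983, §3] -/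
theorem femtoGapOfRecord_of_nearFlatRatioLaw_steps (h₁ : NearFlatRatioLaw) (h₃ : OctaveStepDecay) (h₄ : SubOctaveBounded) :
    Summit.QuantumFields.YangMills.Theorems.FemtoTransferGap.FemtoGapOfRecord :=
  femtoGapOfRecord_of_steps_of_fixedLattice' h₃ h₄ (femtoGapFixedLattice_of_nearFlatRatioLaw h₁)

/-- ★ **The `Assembly` item of route FlatTubeReduction (stmt-QuantumFields-24722)**, by name:
`NearFlatRatioLaw → OffTubeSuppression → OctaveStepDecay → SubOctaveBounded → FemtoGapOfRecord` — K1 ∧ K2 give the fixed-lattice leaf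
(`FemtoCutoffLadder.femtoGapFixedLattice_of_nearFlat_offTube`), then FemtoCutoffLadder's proved tower assembly
(`femtoGapOfRecord_of_steps_of_fixedLattice'`). [cite: LuscherWeiszWolff1991] [cite: Luscher1983, §3] -/
theorem assembly_proof : Summit.QuantumFields.YangMills.Theses.FlatTubeReduction.Assembly :=
  fun h₁ h₂ h₃ h₄ =>
    femtoGapOfRecord_of_steps_of_fixedLattice' h₃ h₄
      (Summit.QuantumFields.YangMills.Theorems.FemtoCutoffLadder.femtoGapFixedLattice_of_nearFlat_offTube h₁ h₂)

end Summit.QuantumFields.YangMills.Theorems.FlatTubeReduction
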